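import Summits.CriticalPhenomena.PercolationContinuityZ3.Theorems.PercNearOneGluingNoHeavyQuantFarSunAvgLargeSigma
import HarnessLib

/-!
# FAR beyond trees: CENTRAL positions at EVERY layer — counting, the flank probability `≥ 1/2` (Chernoff) and the boost lower bound
# `a_k ≥ (1 − h k)/(4K)` (the per-position half of "every layer holds on all long hairy cycles")

builds on p205010 (kernel theorem, internal audit signed; external expert review pending)

Support file (`--supports stmt-CriticalPhenomena-4575`), seat `prim-cert-1` (gen 41); memo `prim-cert-1/FROM-prim-cert-1-g41-ALL-LAYERS.md` §3.
Layer `j ≥ 1`, threshold `M` (used with `M = 2j`).  Generalises the layer-two file `…QuantFarSunAvgCentral` (gen 37, `M = 3`, flank efficiency with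
Cauchy–Schwarz) with CRUDE constants — enough for an existence-of-threshold theorem (`…QuantFarSunLargeK`):  a position `k < K` is `M`-CENTRAL if
`M ≤ Σ_{i<k} h i` and `M ≤ Σ_{k<i<K} h i`;  `h⁰ = update h k 0` (hair `k` removed).

* `HairyCycle.sum_leftLight_lt_gen` / `sum_rightLight_lt_gen` / **`card_central_gt_gen`** — the non-central positions carry hair mass `< 2(M+1)`,
  so there are more than `Σ − 2M − 2` central positions.
* `HairyCycle.mem_wit_insert_gen` — `j` members of `Q` on each side of `k` make `k` a witness of `insert k Q` (layer `j`);
  `HairyCycle.noWit_erase_le_gen` — the patterns avoiding `k` without a witness, weighted without hair `k`, have mass `≤ P_h(T ≤ 2j+1)`.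
* `HairyCycle.flankProb_ge_half` — for `2j ≤ Σ_{i<k} h i`: `P⁰(#(Q ∩ [0,k)) ≥ j) ≥ 1/2` (Chernoff `pow_mul_sum_hairW_count_le_exp` at `θ = 1/2`,
  `2^{j−1}e^{−j} ≤ 1/2` from `e ≥ 2`, cf. `Literature.NumberTheory.LFunctions.FordL34.two_pow_mul_exp_neg_le_one`); same on the right.
* **`HairyCycle.boost_ge_quarter_div`** — for a `2j`-central position `k < K`:
  `(1 − h k)/(4K) ≤ a_k := Σ_{Q ⊆ range K ∖ {k}} hairW K h Q · witAvgKernel j (insert k Q) k`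
  (the kernel mass of a witness is `1/#wit ≥ 1/K`; the two flank events are independent, `sum_hairW_count_mul_count`).
No definitions, no sorries, standard axioms.  Elementary [this work].
-/

noncomputable section

namespace Summit.CriticalPhenomena.PercolationContinuityZ3.Theorems.HairyCycle

open Finset
open scoped Classical

variable {K : ℕ}

/-! ## Counting central positions (threshold `M`) -/

/-- The positions with left mass `< M` carry total mass `< M + 1` (`0 ≤ h ≤ 1`, `0 ≤ M`). [this work] -/
theorem sum_leftLight_lt_gen {h : ℕ → ℝ} (hh : ∀ k, k < K → 0 ≤ h k ∧ h k ≤ 1) {M : ℝ} (hM : 0 ≤ M) :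
    ∑ k ∈ (range K).filter (fun k => ∑ i ∈ range k, h i < M), h k < M + 1 := by
  set P := (range K).filter (fun k => ∑ i ∈ range k, h i < M) with hP
  by_cases hne : P.Nonempty
  · set m := P.max' hne with hm
    have hmP : m ∈ P := Finset.max'_mem P hne
    rw [hP, Finset.mem_filter, Finset.mem_range] at hmP
    have hsub : P ⊆ range (m + 1) := fun k hk => Finset.mem_range.2 (Nat.lt_succ_of_le (Finset.le_max' P k hk))
    calc ∑ k ∈ P, h k ≤ ∑ k ∈ range (m + 1), h k :=
          Finset.sum_le_sum_of_subset_of_nonneg hsub fun k hk _ => (hh k (by rw [Finset.mem_range] at hk; omega)).1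
      _ = ∑ i ∈ range m, h i + h m := Finset.sum_range_succ _ _
      _ < M + 1 := by linarith [hmP.2, (hh m hmP.1).2]
  · rw [Finset.not_nonempty_iff_eq_empty.1 hne, Finset.sum_empty]; linarith

/-- The positions with right mass `< M` carry total mass `< M + 1` (`0 ≤ h ≤ 1`, `0 ≤ M`). [this work] -/
theorem sum_rightLight_lt_gen {h : ℕ → ℝ} (hh : ∀ k, k < K → 0 ≤ h k ∧ h k ≤ 1) {M : ℝ} (hM : 0 ≤ M) :
    ∑ k ∈ (range K).filter (fun k => ∑ i ∈ (range K).filter (fun i => k < i), h i < M), h k < M + 1 := by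
  set S := (range K).filter (fun k => ∑ i ∈ (range K).filter (fun i => k < i), h i < M) with hS
  by_cases hne : S.Nonempty
  · set m := S.min' hne with hm
    have hmS : m ∈ S := Finset.min'_mem S hne
    rw [hS, Finset.mem_filter, Finset.mem_range] at hmS
    have hsub : S ⊆ insert m ((range K).filter (fun i => m < i)) := by
      intro k hk
      have hmk : m ≤ k := Finset.min'_le S k hk
      rw [Finset.mem_insert, Finset.mem_filter, Finset.mem_range]
      rcases eq_or_lt_of_le hmk with e | hlt
      · exact Or.inl e.symm
      · exact Or.inr ⟨(Finset.mem_range.1 (Finset.mem_filter.1 hk).1), hlt⟩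
    have hm_notin : m ∉ (range K).filter (fun i => m < i) := by simp
    calc ∑ k ∈ S, h k ≤ ∑ k ∈ insert m ((range K).filter (fun i => m < i)), h k :=
          Finset.sum_le_sum_of_subset_of_nonneg hsub fun k hk _ => by
            rw [Finset.mem_insert, Finset.mem_filter, Finset.mem_range] at hk
            rcases hk with rfl | hk
            · exact (hh _ hmS.1).1
            · exact (hh k hk.1).1
      _ = h m + ∑ i ∈ (range K).filter (fun i => m < i), h i := Finset.sum_insert hm_notin
      _ < M + 1 := by linarith [hmS.2, (hh m hmS.1).2]
  · rw [Finset.not_nonempty_iff_eq_empty.1 hne, Finset.sum_empty]; linarith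

/-- **More than `Σ − 2M − 2` central positions.**  With `Cen = {k < K : M ≤ Σ_{i<k} h i ∧ M ≤ Σ_{k<i<K} h i}`:
`Σ_{k<K} h k − (2M + 2) < #Cen` (`0 ≤ h ≤ 1`, `0 ≤ M`). [this work] -/
theorem card_central_gt_gen {h : ℕ → ℝ} (hh : ∀ k, k < K → 0 ≤ h k ∧ h k ≤ 1) {M : ℝ} (hM : 0 ≤ M) :
    ∑ k ∈ range K, h k - (2 * M + 2) <
      (((range K).filter (fun k => M ≤ ∑ i ∈ range k, h i ∧ M ≤ ∑ i ∈ (range K).filter (fun i => k < i), h i)).card : ℝ) := by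
  set Cen := (range K).filter (fun k => M ≤ ∑ i ∈ range k, h i ∧ M ≤ ∑ i ∈ (range K).filter (fun i => k < i), h i) with hCen
  set P := (range K).filter (fun k => ∑ i ∈ range k, h i < M) with hP
  set S := (range K).filter (fun k => ∑ i ∈ (range K).filter (fun i => k < i), h i < M) with hS
  have hcover : range K \ Cen ⊆ P ∪ S := by
    intro k hk
    rw [Finset.mem_sdiff, hCen, Finset.mem_filter] at hk
    rw [Finset.mem_union, hP, hS, Finset.mem_filter, Finset.mem_filter]
    by_cases h1 : ∑ i ∈ range k, h i < M
    · exact Or.inl ⟨hk.1, h1⟩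
    · right
      refine ⟨hk.1, ?_⟩
      by_contra h2
      exact hk.2 ⟨hk.1, le_of_not_gt h1, le_of_not_gt h2⟩
  have hnn : ∀ k ∈ range K, 0 ≤ h k := fun k hk => (hh k (Finset.mem_range.1 hk)).1
  have h1 : ∑ k ∈ range K, h k = ∑ k ∈ Cen, h k + ∑ k ∈ range K \ Cen, h k := by
    rw [← Finset.sum_sdiff (Finset.filter_subset _ _ : Cen ⊆ range K)]; ring
  have h2 : ∑ k ∈ range K \ Cen, h k ≤ ∑ k ∈ P ∪ S, h k :=
    Finset.sum_le_sum_of_subset_of_nonneg hcover fun k hk _ => by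
      rw [Finset.mem_union, hP, hS] at hk
      rcases hk with hk | hk <;> exact hnn k (Finset.mem_filter.1 hk).1
  have h3 : ∑ k ∈ P ∪ S, h k ≤ ∑ k ∈ P, h k + ∑ k ∈ S, h k := by
    rw [← Finset.sum_union_inter]
    have : 0 ≤ ∑ k ∈ P ∩ S, h k := Finset.sum_nonneg fun k hk => hnn k (Finset.mem_filter.1 (Finset.mem_inter.1 hk).1).1
    linarith
  have h4 : ∑ k ∈ Cen, h k ≤ (Cen.card : ℝ) := by
    have := Finset.sum_le_sum (s := Cen) (f := h) (g := fun _ => (1 : ℝ)) fun k hk => (hh k (Finset.mem_range.1 (Finset.mem_filter.1 hk).1)).2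
    simpa using this
  linarith [sum_leftLight_lt_gen hh hM, sum_rightLight_lt_gen hh hM]

/-! ## Witnesses made by opening a flanked hair -/

/-- If a pattern `Q ∌ k` has at least `j` members on each side of `k`, then `k` is a witness of `insert k Q` (layer `j`). [this work] -/
theorem mem_wit_insert_gen {j k : ℕ} {Q : Finset ℕ} (ha : j ≤ (Q ∩ range k).card) (hb : j ≤ (Q ∩ (range K).filter (fun i => k < i)).card) :
    k ∈ wit j (insert k Q) := by
  refine Finset.mem_filter.2 ⟨Finset.mem_insert_self k Q, ?_, ?_⟩
  · refine ha.trans (Finset.card_le_card fun e he => ?_)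
    rw [Finset.mem_inter, Finset.mem_range] at he
    exact Finset.mem_filter.2 ⟨Finset.mem_insert_of_mem he.1, he.2⟩
  · refine hb.trans (Finset.card_le_card fun e he => ?_)
    rw [Finset.mem_inter, Finset.mem_filter] at he
    exact Finset.mem_filter.2 ⟨Finset.mem_insert_of_mem he.1, he.2.2⟩

/-- **`P_k ≤ P(T ≤ 2j+1)`**: the patterns avoiding `k` without a witness (layer `j`), weighted without hair `k`, have mass at most
`Σ_Q hairW K h Q·𝟙[#Q ≤ 2j+1]`. [this work] -/
theorem noWit_erase_le_gen {h : ℕ → ℝ} (hh : ∀ i, i < K → 0 ≤ h i ∧ h i ≤ 1) (j : ℕ) {k : ℕ} (hk : k < K) :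
    ∑ Q ∈ ((range K).erase k).powerset, hairW K (Function.update h k 0) Q * (if (wit j Q).Nonempty then (0 : ℝ) else 1) ≤
      ∑ Q ∈ (range K).powerset, hairW K h Q * (if (Q ∩ range K).card ≤ 2 * j + 1 then (1 : ℝ) else 0) := by
  have hkS : k ∉ (range K).erase k := Finset.notMem_erase k _
  have hins : insert k ((range K).erase k) = range K := Finset.insert_erase (Finset.mem_range.2 hk)
  have hpw : (range K).powerset = (insert k ((range K).erase k)).powerset := by rw [hins]
  rw [hpw, Finset.sum_powerset_insert hkS, ← Finset.sum_add_distrib]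
  refine Finset.sum_le_sum fun Q hQ => ?_
  rw [Finset.mem_powerset] at hQ
  have hkQ : k ∉ Q := fun hm => hkS (hQ hm)
  have h1 := hairW_nonneg hh Q
  have h2 := hairW_nonneg hh (insert k Q)
  by_cases hne : (wit j Q).Nonempty
  · rw [if_pos hne, mul_zero]
    exact add_nonneg (mul_nonneg h1 (by split_ifs <;> norm_num)) (mul_nonneg h2 (by split_ifs <;> norm_num))
  · have hc : Q.card ≤ 2 * j := card_le_of_wit_not_nonempty hne
    have hc1 : (Q ∩ range K).card ≤ 2 * j + 1 := (Finset.card_le_card Finset.inter_subset_left).trans (by omega)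
    have hc2 : (insert k Q ∩ range K).card ≤ 2 * j + 1 :=
      (Finset.card_le_card Finset.inter_subset_left).trans ((Finset.card_insert_le k Q).trans (by omega))
    simp only [if_neg hne, if_pos hc1, if_pos hc2, mul_one]
    rw [hairW_update_zero_eq_add h hk hkQ]

/-! ## The flank probability of a heavy side is at least one half -/

/-- **Flank probability, left**: if `1 ≤ j`, `0 ≤ h ≤ 1` on `range K` and the hair mass of `C ⊆ range K` is at least `2j`
(`2j ≤ Σ_{i ∈ range K, i ∈ C} h i`), then `P(#(Q ∩ C) ≥ j) = Σ_Q hairW K h Q·𝟙[j ≤ #(Q∩C)] ≥ 1/2`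
(Chernoff at `θ = 1/2`: `P(#(Q∩C) ≤ j−1) ≤ 2^{j−1} e^{−j} ≤ 1/2`). [this work] -/
theorem flankProb_ge_half {h : ℕ → ℝ} (hh : ∀ k, k < K → 0 ≤ h k ∧ h k ≤ 1) {j : ℕ} (hj : 1 ≤ j) (C : Finset ℕ)
    (hmass : (2 * j : ℝ) ≤ ∑ i ∈ (range K).filter (fun i => i ∈ C), h i) :
    (1 / 2 : ℝ) ≤ ∑ Q ∈ (range K).powerset, hairW K h Q * (if j ≤ (Q ∩ C).card then (1 : ℝ) else 0) := by
  obtain ⟨j', rfl⟩ : ∃ j', j = j' + 1 := ⟨j - 1, by omega⟩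
  have hc := pow_mul_sum_hairW_count_le_exp hh C j' (θ := 1 / 2) (by norm_num) (by norm_num)
  -- `e^{−(1/2)·mass} ≤ e^{−j}`
  have hexp : Real.exp (-(1 - 1 / 2) * ∑ i ∈ (range K).filter (fun i => i ∈ C), h i) ≤ Real.exp (-((j' + 1 : ℕ) : ℝ)) := by
    apply Real.exp_le_exp.2
    have : (((j' + 1 : ℕ) : ℝ)) ≤ (1 - 1 / 2) * ∑ i ∈ (range K).filter (fun i => i ∈ C), h i := by
      push_cast at hmass ⊢; linarith
    linarith
  -- so `P(≤ j') ≤ 2^{j'} e^{−(j'+1)} ≤ 1/2`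
  set Plow := ∑ Q ∈ (range K).powerset, hairW K h Q * (if (Q ∩ C).card ≤ j' then (1 : ℝ) else 0) with hPlow
  have hP2 : Plow ≤ (2 : ℝ) ^ j' * Real.exp (-((j' + 1 : ℕ) : ℝ)) := by
    have h1 : (1 / 2 : ℝ) ^ j' * Plow ≤ Real.exp (-((j' + 1 : ℕ) : ℝ)) := hc.trans hexp
    have h2 : (2 : ℝ) ^ j' * ((1 / 2 : ℝ) ^ j' * Plow) = Plow := by
      rw [← mul_assoc, ← mul_pow]; norm_num
    have h3 : (0 : ℝ) ≤ (2 : ℝ) ^ j' := by positivity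
    calc Plow = (2 : ℝ) ^ j' * ((1 / 2 : ℝ) ^ j' * Plow) := h2.symm
      _ ≤ (2 : ℝ) ^ j' * Real.exp (-((j' + 1 : ℕ) : ℝ)) := mul_le_mul_of_nonneg_left h1 h3
  have hhalf : (2 : ℝ) ^ j' * Real.exp (-((j' + 1 : ℕ) : ℝ)) ≤ 1 / 2 := by
    -- `(2/e)^{j'+1} ≤ 1` since `2 ≤ e`
    have h2e : (2 : ℝ) ≤ Real.exp 1 := by
      have := Real.add_one_le_exp (1 : ℝ)
      linarith
    have h1 : (2 : ℝ) ^ (j' + 1) ≤ Real.exp 1 ^ (j' + 1) := pow_le_pow_left₀ (by norm_num) h2e (j' + 1)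
    have h2 : Real.exp 1 ^ (j' + 1) = Real.exp ((j' + 1 : ℕ) : ℝ) := by rw [← Real.exp_nat_mul]; ring_nf
    have h3 : Real.exp ((j' + 1 : ℕ) : ℝ) * Real.exp (-((j' + 1 : ℕ) : ℝ)) = 1 := by rw [← Real.exp_add]; simp
    have h4 : 0 < Real.exp (-((j' + 1 : ℕ) : ℝ)) := Real.exp_pos _
    have h5 : (2 : ℝ) ^ (j' + 1) * Real.exp (-((j' + 1 : ℕ) : ℝ)) ≤ 1 := by nlinarith
    rw [pow_succ] at h5
    linarith
  -- complement: `P(≥ j'+1) = 1 − P(≤ j')`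
  have htot : ∑ Q ∈ (range K).powerset, hairW K h Q * (if j' + 1 ≤ (Q ∩ C).card then (1 : ℝ) else 0) + Plow = 1 := by
    rw [hPlow, ← Finset.sum_add_distrib]
    calc ∑ Q ∈ (range K).powerset, (hairW K h Q * (if j' + 1 ≤ (Q ∩ C).card then (1 : ℝ) else 0) +
            hairW K h Q * (if (Q ∩ C).card ≤ j' then (1 : ℝ) else 0))
        = ∑ Q ∈ (range K).powerset, hairW K h Q := Finset.sum_congr rfl fun Q _ => by
            by_cases hq : j' + 1 ≤ (Q ∩ C).card
            · rw [if_pos hq, if_neg (by omega)]; ring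
            · rw [if_neg hq, if_pos (by omega)]; ring
      _ = 1 := sum_hairW_eq_one h
  linarith

/-! ## The boost of a central position -/

/-- **The boost of position `k` is at least `(1 − h k)/(4K)`** when `k < K` is `2j`-central (`1 ≤ j`, `0 ≤ h ≤ 1` on `range K`):
`(1 − h k)/(4K) ≤ Σ_{Q ⊆ range K ∖ {k}} hairW K h Q · witAvgKernel j (insert k Q) k`.  Opening `k` on a pattern with `≥ j` open hairs
on each side makes `k` a witness with kernel mass `1/#wit ≥ 1/K`; the two sides are independent and each is heavy with probability `≥ 1/2`. [this work] -/
theorem boost_ge_quarter_div {h : ℕ → ℝ} (hh : ∀ i, i < K → 0 ≤ h i ∧ h i ≤ 1) {j : ℕ} (hj : 1 ≤ j) {k : ℕ} (hk : k < K)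
    (hL : (2 * j : ℝ) ≤ ∑ i ∈ range k, h i) (hR : (2 * j : ℝ) ≤ ∑ i ∈ (range K).filter (fun i => k < i), h i) :
    (1 - h k) / (4 * K) ≤ ∑ Q ∈ ((range K).erase k).powerset, hairW K h Q * witAvgKernel j (insert k Q) k := by
  set h0 := Function.update h k 0 with hh0def
  have hh0 : ∀ i, i < K → 0 ≤ h0 i ∧ h0 i ≤ 1 := by
    intro i hi
    by_cases hik : i = k
    · rw [hik, hh0def, Function.update_self]; norm_num
    · rw [hh0def, Function.update_of_ne hik]; exact hh i hi
  have hKpos : (0 : ℝ) < K := by exact_mod_cast (show 0 < K by omega)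
  set L := range k with hLdef
  set R := (range K).filter (fun i => k < i) with hRdef
  have hLR : Disjoint L R := by
    rw [Finset.disjoint_left]; intro e he he'
    rw [hLdef, Finset.mem_range] at he; rw [hRdef, Finset.mem_filter] at he'; omega
  -- the flank product under `h0`
  set g : Finset ℕ → ℝ := fun Q => (if j ≤ (Q ∩ L).card then (1 : ℝ) else 0) * (if j ≤ (Q ∩ R).card then (1 : ℝ) else 0) with hgdef
  -- masses of the sides under `h0` (`k ∉ L`, `k ∉ R`)
  have hmassL : (2 * j : ℝ) ≤ ∑ i ∈ (range K).filter (fun i => i ∈ L), h0 i := by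
    have e : ∑ i ∈ (range K).filter (fun i => i ∈ L), h0 i = ∑ i ∈ range k, h i := by
      have hf : (range K).filter (fun i => i ∈ L) = range k := by
        ext i; simp only [Finset.mem_filter, Finset.mem_range, hLdef]; omega
      rw [hf]
      exact Finset.sum_congr rfl fun i hi => by
        rw [hh0def, Function.update_of_ne]; rw [Finset.mem_range] at hi; omega
    rw [e]; exact hL
  have hmassR : (2 * j : ℝ) ≤ ∑ i ∈ (range K).filter (fun i => i ∈ R), h0 i := by
    have e : ∑ i ∈ (range K).filter (fun i => i ∈ R), h0 i = ∑ i ∈ R, h i := by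
      have hf : (range K).filter (fun i => i ∈ R) = R := by
        ext i; simp only [Finset.mem_filter, Finset.mem_range, hRdef]; tauto
      rw [hf]
      exact Finset.sum_congr rfl fun i hi => by
        rw [hh0def, Function.update_of_ne]; rw [hRdef, Finset.mem_filter] at hi; omega
    rw [e]; exact hR
  have hPL := flankProb_ge_half hh0 hj L hmassL
  have hPR := flankProb_ge_half hh0 hj R hmassR
  have hprod : ∑ Q ∈ (range K).powerset, hairW K h0 Q * g Q =
      (∑ Q ∈ (range K).powerset, hairW K h0 Q * (if j ≤ (Q ∩ L).card then (1 : ℝ) else 0)) *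
        (∑ Q ∈ (range K).powerset, hairW K h0 Q * (if j ≤ (Q ∩ R).card then (1 : ℝ) else 0)) :=
    sum_hairW_count_mul_count h0 hLR K (fun a => if j ≤ a then (1 : ℝ) else 0) (fun b => if j ≤ b then (1 : ℝ) else 0)
  have hquarter : (1 / 4 : ℝ) ≤ ∑ Q ∈ (range K).powerset, hairW K h0 Q * g Q := by
    rw [hprod]; nlinarith
  -- patterns containing `k` have no weight under `h0`: restrict to `Q ⊆ range K ∖ {k}`
  have hkS : k ∉ (range K).erase k := Finset.notMem_erase k _
  have hrestrict : ∑ Q ∈ (range K).powerset, hairW K h0 Q * g Q = ∑ Q ∈ ((range K).erase k).powerset, hairW K h0 Q * g Q := by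
    symm
    refine Finset.sum_subset (Finset.powerset_mono.2 (Finset.erase_subset k (range K))) fun Q hQ hQ' => ?_
    rw [Finset.mem_powerset] at hQ hQ'
    have hkQ : k ∈ Q := by
      by_contra hkQ
      exact hQ' fun e he => Finset.mem_erase.2 ⟨fun hek => hkQ (hek ▸ he), hQ he⟩
    rw [hairW_eq_zero_of_mem hk hkQ (by rw [hh0def, Function.update_self]), zero_mul]
  -- pointwise: `(1 − h k)·hairW h0 Q·g Q / K ≤ hairW h Q · kernel`
  have hpt : ∀ Q ∈ ((range K).erase k).powerset,
      (1 - h k) * (hairW K h0 Q * g Q) / K ≤ hairW K h Q * witAvgKernel j (insert k Q) k := by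
    intro Q hQ
    rw [Finset.mem_powerset] at hQ
    have hkQ : k ∉ Q := fun hm => hkS (hQ hm)
    rw [hairW_eq_mul_erase h hk hkQ, ← hh0def]
    have hw0 : 0 ≤ hairW K h0 Q := hairW_nonneg hh0 Q
    have hu : 0 ≤ 1 - h k := by linarith [(hh k hk).2]
    by_cases hab : j ≤ (Q ∩ L).card ∧ j ≤ (Q ∩ R).card
    · have hg1 : g Q = 1 := by rw [hgdef]; simp only [if_pos hab.1, if_pos hab.2, mul_one]
      rw [hg1, mul_one]
      have hmem := mem_wit_insert_gen (K := K) hab.1 hab.2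
      unfold witAvgKernel
      rw [if_pos hmem]
      have hcard : ((wit j (insert k Q)).card : ℝ) ≤ K := by
        have h1 : (wit j (insert k Q)).card ≤ (insert k Q).card := Finset.card_le_card fun d hd => mem_of_mem_wit hd
        have h2 : (insert k Q).card ≤ (range K).card :=
          Finset.card_le_card (Finset.insert_subset (Finset.mem_range.2 hk) (hQ.trans (Finset.erase_subset _ _)))
        rw [Finset.card_range] at h2
        exact_mod_cast h1.trans h2
      have hpos : (0 : ℝ) < (wit j (insert k Q)).card := by exact_mod_cast Finset.card_pos.2 ⟨k, hmem⟩
      have hdiv : 1 / (K : ℝ) ≤ 1 / ((wit j (insert k Q)).card : ℝ) := one_div_le_one_div_of_le hpos hcard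
      have e : (1 - h k) * hairW K h0 Q / K = (1 - h k) * hairW K h0 Q * (1 / K) := by ring
      rw [e]
      exact mul_le_mul_of_nonneg_left hdiv (mul_nonneg hu hw0)
    · have hg0 : g Q = 0 := by
        rcases not_and_or.1 hab with h1 | h1
        · simp only [hgdef, if_neg h1, zero_mul]
        · simp only [hgdef, if_neg h1, mul_zero]
      rw [hg0, mul_zero, mul_zero, zero_div]
      refine mul_nonneg (mul_nonneg hu hw0) ?_
      unfold witAvgKernel
      split_ifs
      · exact div_nonneg zero_le_one (Nat.cast_nonneg _)
      · exact le_rfl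
  have hsum := Finset.sum_le_sum hpt
  rw [← Finset.sum_div, ← Finset.mul_sum, ← hrestrict] at hsum
  calc (1 - h k) / (4 * K) = (1 - h k) * (1 / 4) / K := by ring
    _ ≤ (1 - h k) * (∑ Q ∈ (range K).powerset, hairW K h0 Q * g Q) / K := by
        apply div_le_div_of_nonneg_right _ hKpos.le
        exact mul_le_mul_of_nonneg_left hquarter (by linarith [(hh k hk).2])
    _ ≤ _ := hsum

end Summit.CriticalPhenomena.PercolationContinuityZ3.Theorems.HairyCycle

end
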